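import Literature.Probability.Percolation.SiteEmbDomainCrossing

/-!
# Neutrality of star refinements for site-percolation crossing events

Helper file for the crux `QuadrupoleSelectionRule` (stmt-CriticalPhenomena-7029, informal) of route
`CardyFlipRusso` (sub-problem `CardyFormulaZ2`), line `Sketch`: the combinatorial content of the
"wanted lemma (2)" of `Literature/Probability/Percolation/FlipResponse.lean` — **star refinements
are neutral** (Beffara 2008, §2.6): inserting a new vertex `v` inside a triangular face `ABC` of a
triangulation and joining it to `A`, `B`, `C` does not change ANY crossing event between sets of
old vertices, configuration by configuration (not just in probability).  Indeed a path through
`v` enters and leaves through two of the mutually adjacent vertices `A, B, C`, so the detour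
through `v` can be cut short.

The refinement is modelled on a fixed vertex type: `v` is an isolated vertex of `G` (the vertex
"to be inserted"), and the refined graph is `G ⊔ fromEdgeSet {vA, vB, vC}`.

## Contents (namespace `Summit.CriticalPhenomena.CardyFormulaZ2.Theorems`)

* `starRefine_adj_of_ne`, `mem_corners_of_starRefine_adj` — edges of the refined graph;
* `siteConnIn_starRefine_iff` — `{x ⟷ y in S}` is the same event in `G` and in the refined graph
  for all old vertices `x, y ≠ v`;
* `crossing_starRefine_eq` — hence every crossing event `{∃ u ∈ X, ∃ w ∈ Y, u ⟷ w in S}` with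
  `v ∉ X ∪ Y` is literally the same set of configurations (so its probability under any law, and
  every flip response elsewhere, is unchanged: vertex insertion in the thinning/superposition leg
  of the route is flip-reducible).

## References

* V. Beffara, *Is critical 2D percolation universal?* (2008), §2.6 (refinements of self-matching
  triangulations).
-/

noncomputable section

namespace Summit.CriticalPhenomena.CardyFormulaZ2.Theorems

open Literature.Probability.Percolation

variable {V : Type*}

/-- An edge of the star-refined graph `G ⊔ {vA, vB, vC}` between two vertices other than `v` is
an edge of `G`. [folklore] -/
theorem starRefine_adj_of_ne {G : SimpleGraph V} {v A B C x y : V}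
    (h : (G ⊔ SimpleGraph.fromEdgeSet {s(v, A), s(v, B), s(v, C)}).Adj x y) (hx : x ≠ v)
    (hy : y ≠ v) : G.Adj x y := by
  rcases (SimpleGraph.sup_adj _ _ _ _).1 h with hG | hE
  · exact hG
  · exfalso
    obtain ⟨hmem, -⟩ := (SimpleGraph.fromEdgeSet_adj _).1 hE
    simp only [Set.mem_insert_iff, Set.mem_singleton_iff, Sym2.eq_iff] at hmem
    rcases hmem with (⟨h1, -⟩ | ⟨-, h2⟩) | (⟨h1, -⟩ | ⟨-, h2⟩) | (⟨h1, -⟩ | ⟨-, h2⟩)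
    all_goals first | exact hx h1 | exact hy h2

/-- A neighbour of `v` in the star-refined graph is one of the corners `A, B, C` (when `v` is
isolated in `G`). [folklore] -/
theorem mem_corners_of_starRefine_adj {G : SimpleGraph V} {v A B C x : V}
    (hv : ∀ w, ¬ G.Adj v w)
    (h : (G ⊔ SimpleGraph.fromEdgeSet {s(v, A), s(v, B), s(v, C)}).Adj x v) :
    x = A ∨ x = B ∨ x = C := by
  have hxv : x ≠ v := h.ne
  rcases (SimpleGraph.sup_adj _ _ _ _).1 h with hG | hE
  · exact absurd hG.symm (hv x)
  · obtain ⟨hmem, -⟩ := (SimpleGraph.fromEdgeSet_adj _).1 hE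
    simp only [Set.mem_insert_iff, Set.mem_singleton_iff, Sym2.eq_iff] at hmem
    rcases hmem with (⟨h1, -⟩ | ⟨h1, -⟩) | (⟨h1, -⟩ | ⟨h1, -⟩) | (⟨h1, -⟩ | ⟨h1, -⟩)
    · exact absurd h1 hxv
    · exact Or.inl h1
    · exact absurd h1 hxv
    · exact Or.inr (Or.inl h1)
    · exact absurd h1 hxv
    · exact Or.inr (Or.inr h1)

/-- Two distinct corners of the face `ABC` are adjacent in `G`. [folklore] -/
theorem adj_of_mem_corners {G : SimpleGraph V} {A B C x y : V} (hAB : G.Adj A B) (hBC : G.Adj B C)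
    (hAC : G.Adj A C) (hx : x = A ∨ x = B ∨ x = C) (hy : y = A ∨ y = B ∨ y = C) (hxy : x ≠ y) :
    G.Adj x y := by
  rcases hx with hx | hx | hx <;> rcases hy with hy | hy | hy <;> rw [hx, hy] <;>
    first
      | exact absurd (hx.trans hy.symm) hxy
      | exact hAB
      | exact hAB.symm
      | exact hBC
      | exact hBC.symm
      | exact hAC
      | exact hAC.symm

/-- **Star refinements are neutral for connection events.** If `v` is an isolated vertex of `G`
and `A, B, C` are pairwise adjacent in `G`, then for all vertices `x, y ≠ v` the event
`{x ⟷ y in S}` is the same for `G` and for the star-refined graph `G ⊔ {vA, vB, vC}`: a detour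
`P – v – Q` through `v` has `P, Q ∈ {A, B, C}` open and is replaced by the edge `PQ` (or deleted
if `P = Q`). [folklore] -/
theorem siteConnIn_starRefine_iff {G : SimpleGraph V} {v A B C : V} (hv : ∀ w, ¬ G.Adj v w)
    (hAB : G.Adj A B) (hBC : G.Adj B C) (hAC : G.Adj A C) (S : Set V) {x y : V} (hx : x ≠ v)
    (hy : y ≠ v) (ω : SiteConfig V) :
    ω ∈ siteConnIn (G ⊔ SimpleGraph.fromEdgeSet {s(v, A), s(v, B), s(v, C)}) S x y ↔
      ω ∈ siteConnIn G S x y := by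
  refine ⟨fun h => ?_, fun h => siteConnIn_mono_graph le_sup_left S x y h⟩
  obtain ⟨hxω, hyω, hxS, hyS, hr⟩ := h
  refine ⟨hxω, hyω, hxS, hyS, ?_⟩
  -- the two induced open graphs
  set G' := G ⊔ SimpleGraph.fromEdgeSet {s(v, A), s(v, B), s(v, C)} with hG'
  set H' := (siteOpenGraph G' ω).induce S with hH'
  set H := (siteOpenGraph G ω).induce S with hH
  have adjH' : ∀ (a b : S), H'.Adj a b ↔ G'.Adj a b ∧ (a : V) ∈ ω ∧ (b : V) ∈ ω := fun a b => by
    simp only [hH', SimpleGraph.comap_adj, Function.Embedding.coe_subtype, siteOpenGraph_adj]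
  have adjH : ∀ (a b : S), H.Adj a b ↔ G.Adj a b ∧ (a : V) ∈ ω ∧ (b : V) ∈ ω := fun a b => by
    simp only [hH, SimpleGraph.comap_adj, Function.Embedding.coe_subtype, siteOpenGraph_adj]
  -- (a) an `H'`-edge avoiding `v` is an `H`-edge
  have hedge : ∀ {a b : S}, H'.Adj a b → (a : V) ≠ v → (b : V) ≠ v → H.Adj a b := by
    intro a b hab ha hb
    obtain ⟨hG, haω, hbω⟩ := (adjH' a b).1 hab
    exact (adjH a b).2 ⟨starRefine_adj_of_ne hG ha hb, haω, hbω⟩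
  -- (b) two `H'`-neighbours of `v` are `H`-reachable from each other
  have hdetour : ∀ {e a c : S}, H'.Adj e a → H'.Adj a c → (a : V) = v → H.Reachable e c := by
    intro e a c hea hac ha
    obtain ⟨hG₁, heω, -⟩ := (adjH' e a).1 hea
    obtain ⟨hG₂, -, hcω⟩ := (adjH' a c).1 hac
    rw [ha] at hG₁ hG₂
    have he := mem_corners_of_starRefine_adj hv hG₁
    have hc := mem_corners_of_starRefine_adj hv hG₂.symm
    by_cases hec : e = c
    · rw [hec]
    · have hne : (e : V) ≠ (c : V) := fun h => hec (Subtype.ext h)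
      exact SimpleGraph.Adj.reachable ((adjH e c).2 ⟨adj_of_mem_corners hAB hBC hAC he hc hne, heω, hcω⟩)
  -- two-state induction along a walk
  have key : ∀ (a b : S) (p : H'.Walk a b), (b : V) ≠ v →
      (((a : V) ≠ v → H.Reachable a b) ∧
        ((a : V) = v → ∀ e : S, H'.Adj e a → (e : V) ≠ v → H.Reachable e b)) := by
    intro a b p hb
    induction p with
    | nil =>
      exact ⟨fun _ => SimpleGraph.Reachable.refl _, fun ha => absurd ha hb⟩
    | @cons a c b' hac p' ih =>
      obtain ⟨ih1, ih2⟩ := ih hb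
      refine ⟨fun ha => ?_, fun ha e hea he => ?_⟩
      · by_cases hc : (c : V) = v
        · exact ih2 hc a hac ha
        · exact (hedge hac ha hc).reachable.trans (ih1 hc)
      · have hc : (c : V) ≠ v := fun hc => hac.ne (Subtype.ext (ha.trans hc.symm))
        exact (hdetour hea hac ha).trans (ih1 hc)
  obtain ⟨p⟩ := hr
  exact (key _ _ p hy).1 hx

/-- **Star refinements are neutral for crossing events.** With `v` isolated in `G`, `A, B, C`
pairwise adjacent and `v ∉ X ∪ Y`, the crossing event `{∃ u ∈ X, ∃ w ∈ Y, u ⟷ w in S}` is the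
same set of configurations for `G` and for the star-refined graph; in particular it has the same
probability under every law, and inserting `v` changes no flip response elsewhere. [folklore] -/
theorem crossing_starRefine_eq {G : SimpleGraph V} {v A B C : V} (hv : ∀ w, ¬ G.Adj v w)
    (hAB : G.Adj A B) (hBC : G.Adj B C) (hAC : G.Adj A C) (S X Y : Set V) (hvX : v ∉ X)
    (hvY : v ∉ Y) :
    {ω : SiteConfig V | ∃ u ∈ X, ∃ w ∈ Y,
        ω ∈ siteConnIn (G ⊔ SimpleGraph.fromEdgeSet {s(v, A), s(v, B), s(v, C)}) S u w}
      = {ω | ∃ u ∈ X, ∃ w ∈ Y, ω ∈ siteConnIn G S u w} := by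
  ext ω
  simp only [Set.mem_setOf_eq]
  constructor
  · rintro ⟨u, hu, w, hw, h⟩
    exact ⟨u, hu, w, hw, (siteConnIn_starRefine_iff hv hAB hBC hAC S
      (fun h' => hvX (h' ▸ hu)) (fun h' => hvY (h' ▸ hw)) ω).1 h⟩
  · rintro ⟨u, hu, w, hw, h⟩
    exact ⟨u, hu, w, hw, siteConnIn_mono_graph le_sup_left S u w h⟩

end Summit.CriticalPhenomena.CardyFormulaZ2.Theorems

end
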